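import Summits.QuantumFields.YangMills.Theorems.IsotropyFromPowerCountingTemperedCurvatureMomentsThreePointChartBoundsTranslation

/-!
# Three-point chart bounds IV: the pair vector and the core bound for ordered pairs

Support file for stub `stub_threePointChartBounds` (B) of reshape 4 of
`Cruxes/TemperedCurvatureMoments/Lines/Sketch.lean` (crux stmt-QuantumFields-17721, line `Sketch`).
The reflected pair `(conj f₂∘θ) ⊗ (conj f₁∘θ)` of an `e₀`-ordered pair below the mirror is time-ordered, its
OS adjoint is `f₁ ⊗ f₂`, `‖Ψ_pair‖² ≤ |C₄|(2^{M₄+1})⁴|f₁|²|f₂|²`, and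
`|𝔖₃(f₁ ⊗ f₂ ⊗ ∂_wᴺ g)| = |⟪Ψ_pair, Ψ_{∂ᴺ g}⟫| ≤ ‖Ψ_pair‖ ‖Ψ_{∂ᴺg}‖` (standard frame, mirror at `0`).
References: Osterwalder–Schrader, Comm. Math. Phys. 31 (1973) §4.1, 42 (1975) §4; Glimm–Jaffe, Quantum
Physics (1987) Thm. 6.1.3, §19.5. [folklore]
-/

noncomputable section

open scoped InnerProductSpace ComplexConjugate
open MeasureTheory Filter Set Complex
open _root_.Topology
open Literature.MathematicalPhysics.AQFT Literature.MathematicalPhysics.QuantumLattice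
open Literature.MathematicalPhysics.QuantumFieldTheory
open scoped SchwartzMap LineDeriv
open Literature.MathematicalPhysics.QuantumLattice.SchwingerFamily (timeVec)
open Summit.QuantumFields.YangMills.Theorems.CurvatureKernel
open Summit.QuantumFields.YangMills.Cruxes.PlanarSpectralCone.TwoMirrorLightconeSlots.DiscSections (translateMulti_time_space)

namespace Summit.QuantumFields.YangMills.Theorems.TemperedCurvatureMoments.Sketch.ThreePointChartBounds

/-! ## The pair vector and the three-point core bound in the standard frame -/

section Pair

/-- Coordinates of points in the support of a tensor product lie in the factor supports. [folklore] -/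
theorem apply_mem_tsupport_of_mem_tsupport_tensorFin {n : ℕ} (f : Fin n → 𝓢(EuclideanSpace ℝ (Fin 4), ℂ))
    {x : Fin n → EuclideanSpace ℝ (Fin 4)}
    (hx : x ∈ tsupport (SchwartzMap.tensorFin n f : (Fin n → EuclideanSpace ℝ (Fin 4)) → ℂ)) (i : Fin n) :
    x i ∈ tsupport (f i : EuclideanSpace ℝ (Fin 4) → ℂ) := by
  have hK : IsClosed ((fun y : Fin n → EuclideanSpace ℝ (Fin 4) => y i) ⁻¹'
      tsupport (f i : EuclideanSpace ℝ (Fin 4) → ℂ)) :=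
    (isClosed_tsupport _).preimage (continuous_apply i)
  have hsub : Function.support (SchwartzMap.tensorFin n f : (Fin n → EuclideanSpace ℝ (Fin 4)) → ℂ) ⊆
      (fun y : Fin n → EuclideanSpace ℝ (Fin 4) => y i) ⁻¹' tsupport (f i : EuclideanSpace ℝ (Fin 4) → ℂ) := by
    intro y hy
    rw [Function.mem_support, SchwartzMap.tensorFin_apply] at hy
    exact subset_tsupport _ (Function.mem_support.2 (Finset.prod_ne_zero_iff.1 hy i (Finset.mem_univ i)))
  exact closure_minimal hsub hK hx

/-- **The reflected pair is time-ordered.**  If `supp f₁ ⊆ {y₀ < c'}`, `supp f₂ ⊆ {c' < y₀ < 0}` then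
`(conj f₂∘θ) ⊗ (conj f₁∘θ)` is supported in `{0 < x₀⁰ < x₁⁰}`. [folklore] -/
theorem isTimeOrdered_pair {f₁ f₂ : 𝓢(EuclideanSpace ℝ (Fin 4), ℂ)} {c' : ℝ}
    (hf₁ : tsupport (f₁ : EuclideanSpace ℝ (Fin 4) → ℂ) ⊆ {y | y 0 < c'})
    (hf₂ : tsupport (f₂ : EuclideanSpace ℝ (Fin 4) → ℂ) ⊆ {y | c' < y 0})
    (hf₂' : tsupport (f₂ : EuclideanSpace ℝ (Fin 4) → ℂ) ⊆ {y | y 0 < 0}) :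
    IsTimeOrdered (SchwartzMap.tensorFin 2 ![starTest (thetaTest 4 f₂), starTest (thetaTest 4 f₁)]) := by
  intro x hx
  have hx0 := apply_mem_tsupport_of_mem_tsupport_tensorFin _ hx 0
  have hx1 := apply_mem_tsupport_of_mem_tsupport_tensorFin _ hx 1
  simp only [Matrix.cons_val_zero, Matrix.cons_val_one, Matrix.cons_val_fin_one] at hx0 hx1
  have ha := hf₂ (timeReflection_mem_tsupport_of_mem_tsupport_starTest_thetaTest f₂ hx0)
  have ha' := hf₂' (timeReflection_mem_tsupport_of_mem_tsupport_starTest_thetaTest f₂ hx0)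
  have hb := hf₁ (timeReflection_mem_tsupport_of_mem_tsupport_starTest_thetaTest f₁ hx1)
  simp only [mem_setOf_eq, timeReflection_apply, if_true] at ha ha' hb
  refine ⟨fun i => ?_, fun i j hij => ?_⟩
  · fin_cases i
    · show 0 < x 0 0
      linarith
    · show 0 < x 1 0
      linarith
  · fin_cases i <;> fin_cases j
    · exact absurd hij (lt_irrefl _)
    · show x 0 0 < x 1 0
      linarith
    · exact absurd hij (by decide)
    · exact absurd hij (lt_irrefl _)

/-- **The OS adjoint of the reflected pair is the pair**: `Θ((conj f₂∘θ) ⊗ (conj f₁∘θ))* = f₁ ⊗ f₂`. [folklore] -/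
theorem osAdjoint_pair (f₁ f₂ : 𝓢(EuclideanSpace ℝ (Fin 4), ℂ)) :
    osAdjoint (SchwartzMap.tensorFin 2 ![starTest (thetaTest 4 f₂), starTest (thetaTest 4 f₁)]) =
      SchwartzMap.tensorFin 2 ![f₁, f₂] := by
  ext x
  have h0 : Fin.rev (0 : Fin 2) = 1 := by decide
  have h1 : Fin.rev (1 : Fin 2) = 0 := by decide
  rw [osAdjoint_apply, tensorFin_two_eval, tensorFin_two_eval]
  simp [h0, h1, timeReflection_timeReflection, mul_comm]

/-- The three-point tensor `f₁ ⊗ f₂ ⊗ q` witnesses `Θ(pair)* ⊗ q`. [folklore] -/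
theorem isAppendTensorOf_three (f₁ f₂ q : 𝓢(EuclideanSpace ℝ (Fin 4), ℂ)) :
    IsAppendTensorOf (SchwartzMap.tensorFin 3 ![f₁, f₂, q])
      (osAdjoint (SchwartzMap.tensorFin 2 ![starTest (thetaTest 4 f₂), starTest (thetaTest 4 f₁)]))
      (SchwartzMap.tensorFin 1 ![q]) := by
  rw [osAdjoint_pair]
  intro x
  have hc : (x ∘ Fin.castAdd 1 : Fin 2 → EuclideanSpace ℝ (Fin 4)) = ![x 0, x 1] := by
    funext i; fin_cases i <;> rfl
  have hn : (x ∘ Fin.natAdd 2 : Fin 1 → EuclideanSpace ℝ (Fin 4)) = ![x 2] := by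
    funext i; fin_cases i; rfl
  rw [hc, hn, tensorFin_two_eval, tensorFin_one_eval]
  simp [SchwartzMap.tensorFin_apply, Fin.prod_univ_three, mul_assoc]

/-- The four-point tensor `f₁ ⊗ f₂ ⊗ (conj f₂∘θ) ⊗ (conj f₁∘θ)` witnesses `Θ(pair)* ⊗ pair`. [folklore] -/
theorem isAppendTensorOf_four (f₁ f₂ : 𝓢(EuclideanSpace ℝ (Fin 4), ℂ)) :
    IsAppendTensorOf
      (SchwartzMap.tensorFin 4 ![f₁, f₂, starTest (thetaTest 4 f₂), starTest (thetaTest 4 f₁)])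
      (osAdjoint (SchwartzMap.tensorFin 2 ![starTest (thetaTest 4 f₂), starTest (thetaTest 4 f₁)]))
      (SchwartzMap.tensorFin 2 ![starTest (thetaTest 4 f₂), starTest (thetaTest 4 f₁)]) := by
  rw [osAdjoint_pair]
  intro x
  have hc : (x ∘ Fin.castAdd 2 : Fin 2 → EuclideanSpace ℝ (Fin 4)) = ![x 0, x 1] := by
    funext i; fin_cases i <;> rfl
  have hn : (x ∘ Fin.natAdd 2 : Fin 2 → EuclideanSpace ℝ (Fin 4)) = ![x 2, x 3] := by
    funext i; fin_cases i <;> rfl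
  rw [hc, hn, tensorFin_two_eval, tensorFin_two_eval]
  simp [SchwartzMap.tensorFin_apply, Fin.prod_univ_four, mul_assoc]

variable (S : SchwingerFamily (EuclideanSpace ℝ (Fin 4))) (h : OSReconstructionNoE1 S.toLabelled)

/-- `‖Ψ_F‖² ≤ |𝔖(H)|` for every witness `H` of `ΘF* ⊗ F`. [folklore] -/
theorem norm_fieldVec_sq_le_of_witness {n : ℕ} {F : 𝓢((Fin n → EuclideanSpace ℝ (Fin 4)), ℂ)}
    (hF : IsTimeOrdered F) {H : 𝓢((Fin (n + n) → EuclideanSpace ℝ (Fin 4)), ℂ)}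
    (hH : IsAppendTensorOf H (osAdjoint F) F) :
    ‖h.fieldVec n (fun _ => ()) F hF‖ ^ 2 ≤ ‖S (n + n) H‖ := by
  have h1 : ⟪h.fieldVec n (fun _ => ()) F hF, h.fieldVec n (fun _ => ()) F hF⟫_ℂ = S (n + n) H := by
    rw [h.inner_fieldVec_fieldVec (fun _ => ()) (fun _ => ()) hF hF hH]
    rfl
  rw [← h1, inner_self_eq_norm_sq_to_K]
  norm_cast
  simp

/-- **The four-point value of a pair against its reflection**: `|𝔖₄(f₁⊗f₂⊗θf̄₂⊗θf̄₁)| ≤ |C₄| (2^{M₄+1})⁴ |f₁|² |f₂|²`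
from a temperedness bound `|𝔖₄ F| ≤ C₄ |F|_{M₄}`. [folklore] -/
theorem norm_four_point_pair_le (M₄ : ℕ) (C₄ : ℝ) (hS4 : ∀ F, ‖S 4 F‖ ≤ C₄ * schwartzNorm M₄ F)
    (f₁ f₂ : 𝓢(EuclideanSpace ℝ (Fin 4), ℂ)) :
    ‖S 4 (SchwartzMap.tensorFin 4 ![f₁, f₂, starTest (thetaTest 4 f₂), starTest (thetaTest 4 f₁)])‖ ≤
      |C₄| * (2 ^ (M₄ + 1)) ^ 4 * (schwartzNorm M₄ f₁ ^ 2 * schwartzNorm M₄ f₂ ^ 2) := by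
  refine (hS4 _).trans ?_
  have h1 := schwartzNorm_tensorFin_le ![f₁, f₂, starTest (thetaTest 4 f₂), starTest (thetaTest 4 f₁)] M₄
  rw [Fin.prod_univ_four] at h1
  simp only [Matrix.cons_val_zero, Matrix.cons_val_one, Matrix.cons_val] at h1
  have h1' : schwartzNorm M₄
      (SchwartzMap.tensorFin 4 ![f₁, f₂, starTest (thetaTest 4 f₂), starTest (thetaTest 4 f₁)]) ≤
      (2 ^ (M₄ + 1)) ^ 4 * (schwartzNorm M₄ f₁ * (schwartzNorm M₄ f₂ *
        (schwartzNorm M₄ (starTest (thetaTest 4 f₂)) * schwartzNorm M₄ (starTest (thetaTest 4 f₁))))) := by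
    simpa only [mul_assoc] using h1
  have h2 := schwartzNorm_starTest_thetaTest_le M₄ f₂
  have h3 := schwartzNorm_starTest_thetaTest_le M₄ f₁
  have h4 := schwartzNorm_nonneg M₄ f₁
  have h5 := schwartzNorm_nonneg M₄ f₂
  have h6 := schwartzNorm_nonneg M₄ (starTest (thetaTest 4 f₂))
  have h7 := schwartzNorm_nonneg M₄ (starTest (thetaTest 4 f₁))
  have h8 := schwartzNorm_nonneg M₄
    (SchwartzMap.tensorFin 4 ![f₁, f₂, starTest (thetaTest 4 f₂), starTest (thetaTest 4 f₁)])
  calc C₄ * schwartzNorm M₄ (SchwartzMap.tensorFin 4 ![f₁, f₂, starTest (thetaTest 4 f₂), starTest (thetaTest 4 f₁)])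
      ≤ |C₄| * schwartzNorm M₄
          (SchwartzMap.tensorFin 4 ![f₁, f₂, starTest (thetaTest 4 f₂), starTest (thetaTest 4 f₁)]) :=
        mul_le_mul_of_nonneg_right (le_abs_self C₄) h8
    _ ≤ |C₄| * ((2 ^ (M₄ + 1)) ^ 4 * (schwartzNorm M₄ f₁ * (schwartzNorm M₄ f₂ *
          (schwartzNorm M₄ (starTest (thetaTest 4 f₂)) * schwartzNorm M₄ (starTest (thetaTest 4 f₁)))))) :=
        mul_le_mul_of_nonneg_left h1' (abs_nonneg C₄)
    _ ≤ |C₄| * ((2 ^ (M₄ + 1)) ^ 4 * (schwartzNorm M₄ f₁ * (schwartzNorm M₄ f₂ *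
          (schwartzNorm M₄ f₂ * schwartzNorm M₄ f₁)))) := by gcongr
    _ = |C₄| * (2 ^ (M₄ + 1)) ^ 4 * (schwartzNorm M₄ f₁ ^ 2 * schwartzNorm M₄ f₂ ^ 2) := by ring

/-- **Norm of the pair vector**: `‖Ψ_pair‖² ≤ |C₄| (2^{M₄+1})⁴ |f₁|² |f₂|²`. [folklore] -/
theorem norm_pairVec_sq_le (M₄ : ℕ) (C₄ : ℝ) (hS4 : ∀ F, ‖S 4 F‖ ≤ C₄ * schwartzNorm M₄ F)
    {f₁ f₂ : 𝓢(EuclideanSpace ℝ (Fin 4), ℂ)}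
    (hP : IsTimeOrdered (SchwartzMap.tensorFin 2 ![starTest (thetaTest 4 f₂), starTest (thetaTest 4 f₁)])) :
    ‖h.fieldVec 2 (fun _ => ()) _ hP‖ ^ 2 ≤
      |C₄| * (2 ^ (M₄ + 1)) ^ 4 * (schwartzNorm M₄ f₁ ^ 2 * schwartzNorm M₄ f₂ ^ 2) :=
  (norm_fieldVec_sq_le_of_witness S h hP (isAppendTensorOf_four f₁ f₂)).trans (norm_four_point_pair_le S M₄ C₄ hS4 f₁ f₂)

/-- **The three-point core bound in the standard frame (ordered pair).**  For `𝔖` with E2 and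
translations on `⁰𝒮`, joint spectral measures on the planar cone, and temperedness bounds for `𝔖₂`,
`𝔖₄`: if `supp f₁ ⊆ {y₀ < c'}`, `supp f₂ ⊆ {c' < y₀ < 0}`, `supp g ⊆ {y₀ > δ}` (`0 < δ ≤ 1`) and
`w ∈ {e₀, e₁}`, then `|𝔖₃(f₁ ⊗ f₂ ⊗ ∂_wᴺ g)| ≤ (2N/(e δ/2))ᴺ A B |f₁|_{M₄} |f₂|_{M₄} |g|_{M₂}` with
`A² = |C₄|(2^{M₄+1})⁴`, `B² = 2|C₂|(2^{M₂+1})²16^{M₂}` — Cauchy–Schwarz `|⟪Ψ_pair, Ψ_{∂ᴺg}⟫| ≤ ‖Ψ_pair‖‖Ψ_{∂ᴺg}‖`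
in the OS Hilbert space. [folklore] -/
theorem norm_three_point_core
    (hcone : ∀ (ψ : h.Hilbert) (μ : Measure (EuclideanSpace ℝ (Fin 4))),
      h.IsJointSpectralMeasure ψ μ → μ {p | p 0 < |p 1|} = 0)
    (M₂ : ℕ) (C₂ : ℝ) (hS2 : ∀ F, ‖S 2 F‖ ≤ C₂ * schwartzNorm M₂ F)
    (M₄ : ℕ) (C₄ : ℝ) (hS4 : ∀ F, ‖S 4 F‖ ≤ C₄ * schwartzNorm M₄ F)
    (N : ℕ) {δ : ℝ} (hδ : 0 < δ) (hδ1 : δ ≤ 1) {c' : ℝ} (f₁ f₂ g : 𝓢(EuclideanSpace ℝ (Fin 4), ℂ))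
    (hf₁ : tsupport (f₁ : EuclideanSpace ℝ (Fin 4) → ℂ) ⊆ {y | y 0 < c'})
    (hf₂ : tsupport (f₂ : EuclideanSpace ℝ (Fin 4) → ℂ) ⊆ {y | c' < y 0})
    (hf₂' : tsupport (f₂ : EuclideanSpace ℝ (Fin 4) → ℂ) ⊆ {y | y 0 < 0})
    (hg : tsupport (g : EuclideanSpace ℝ (Fin 4) → ℂ) ⊆ {y | δ < y 0})
    {w : EuclideanSpace ℝ (Fin 4)} (hw : w = EuclideanSpace.single (0 : Fin 4) (1 : ℝ) ∨
      w = EuclideanSpace.single (1 : Fin 4) (1 : ℝ)) :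
    ‖S 3 (SchwartzMap.tensorFin 3 ![f₁, f₂,
        ((∂_{w} : 𝓢(EuclideanSpace ℝ (Fin 4), ℂ) → 𝓢(EuclideanSpace ℝ (Fin 4), ℂ))^[N]) g])‖ ≤
      ((2 * N : ℕ) / (Real.exp 1 * (δ / 2))) ^ N *
        (Real.sqrt (|C₄| * (2 ^ (M₄ + 1)) ^ 4) * Real.sqrt (2 * (|C₂| * (2 ^ (M₂ + 1)) ^ 2 * 16 ^ M₂))) *
        schwartzNorm M₄ f₁ * schwartzNorm M₄ f₂ * schwartzNorm M₂ g := by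
  set q : 𝓢(EuclideanSpace ℝ (Fin 4), ℂ) :=
    ((∂_{w} : 𝓢(EuclideanSpace ℝ (Fin 4), ℂ) → 𝓢(EuclideanSpace ℝ (Fin 4), ℂ))^[N]) g with hqdef
  have hq0 : tsupport (q : EuclideanSpace ℝ (Fin 4) → ℂ) ⊆ {y | 0 < y 0} := fun y hy =>
    lt_trans hδ (hg (tsupport_iterate_lineDerivOp_subset w N g hy))
  have hqT := isTimeOrdered_tensorFin_one hq0
  have hPT := isTimeOrdered_pair hf₁ hf₂ hf₂'
  set ψP : h.Hilbert := h.fieldVec 2 (fun _ => ()) _ hPT with hψP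
  set ψq : h.Hilbert := h.fieldVec 1 (fun _ => ()) _ hqT with hψq
  have hinner : ⟪ψP, ψq⟫_ℂ = S 3 (SchwartzMap.tensorFin 3 ![f₁, f₂, q]) := by
    rw [hψP, hψq, h.inner_fieldVec_fieldVec (fun _ => ()) (fun _ => ()) hPT hqT (isAppendTensorOf_three f₁ f₂ q)]
    rfl
  have hP := norm_pairVec_sq_le S h M₄ C₄ hS4 hPT
  have hQ := norm_fieldVec_iterate_sq_le S h hcone M₂ C₂ hS2 N hδ hδ1 g hg hw hqT
  set A2 : ℝ := |C₄| * (2 ^ (M₄ + 1)) ^ 4 with hA2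
  set B2 : ℝ := 2 * (|C₂| * (2 ^ (M₂ + 1)) ^ 2 * 16 ^ M₂) with hB2
  set r : ℝ := (2 * N : ℕ) / (Real.exp 1 * (δ / 2)) with hr
  have hA2n : 0 ≤ A2 := by positivity
  have hB2n : 0 ≤ B2 := by positivity
  have hr0 : 0 ≤ r := by positivity
  have hCS : ‖S 3 (SchwartzMap.tensorFin 3 ![f₁, f₂, q])‖ ≤ ‖ψP‖ * ‖ψq‖ := by
    rw [← hinner]; exact norm_inner_le_norm ψP ψq
  have hRHS : 0 ≤ r ^ N * (Real.sqrt A2 * Real.sqrt B2) * schwartzNorm M₄ f₁ * schwartzNorm M₄ f₂ *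
      schwartzNorm M₂ g := by
    have := schwartzNorm_nonneg M₄ f₁
    have := schwartzNorm_nonneg M₄ f₂
    have := schwartzNorm_nonneg M₂ g
    positivity
  refine (pow_le_pow_iff_left₀ (norm_nonneg _) hRHS two_ne_zero).1 ?_
  have hsq : (r ^ N * (Real.sqrt A2 * Real.sqrt B2) * schwartzNorm M₄ f₁ * schwartzNorm M₄ f₂ *
      schwartzNorm M₂ g) ^ 2 = (A2 * (schwartzNorm M₄ f₁ ^ 2 * schwartzNorm M₄ f₂ ^ 2)) *
        (r ^ (2 * N) * (B2 * schwartzNorm M₂ g ^ 2)) := by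
    rw [pow_mul' r 2 N]
    have hA := Real.sq_sqrt hA2n
    have hB := Real.sq_sqrt hB2n
    calc (r ^ N * (Real.sqrt A2 * Real.sqrt B2) * schwartzNorm M₄ f₁ * schwartzNorm M₄ f₂ * schwartzNorm M₂ g) ^ 2
        = (Real.sqrt A2 ^ 2 * (schwartzNorm M₄ f₁ ^ 2 * schwartzNorm M₄ f₂ ^ 2)) *
          ((r ^ N) ^ 2 * (Real.sqrt B2 ^ 2 * schwartzNorm M₂ g ^ 2)) := by ring
      _ = _ := by rw [hA, hB]
  rw [hsq]
  calc ‖S 3 (SchwartzMap.tensorFin 3 ![f₁, f₂, q])‖ ^ 2 ≤ (‖ψP‖ * ‖ψq‖) ^ 2 :=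
        pow_le_pow_left₀ (norm_nonneg _) hCS 2
    _ = ‖ψP‖ ^ 2 * ‖ψq‖ ^ 2 := by ring
    _ ≤ (A2 * (schwartzNorm M₄ f₁ ^ 2 * schwartzNorm M₄ f₂ ^ 2)) * (r ^ (2 * N) * (B2 * schwartzNorm M₂ g ^ 2)) :=
        mul_le_mul hP hQ (sq_nonneg _) (by positivity)

end Pair

end Summit.QuantumFields.YangMills.Theorems.TemperedCurvatureMoments.Sketch.ThreePointChartBounds

end
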